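/-
Copyright (c) 2026 the pub-hodgecm2 formalisation cell (harness21).  New file.
Origin: seat `prover-pub-hodgecm2-item6-p3-g15-0` (unit pub-hodgecm2-item6-p3, gen 15; X3-ω ∕ item-(vi) lineage, author lineage of
`Transposition/Item6RestOfChar{,Rep}.lean`), 2026-08-23 — **h411 SHRINK**.  The END of record (✔ `CorCM/PortJoin/ClosedPrinted.lean`,
edition 1 p372014) DISPLAYS `h411 := ∀ i μ hμ hw, Def411AsPrinted (toThm418Data _ (restOfCharDeltaPrime … 𝕣 μ hμ hw))` — [Liu2021, Def. 4.11]
AS PRINTED at the δ′ rests of record: «irreducible-or-zero ∧ smooth ∧ admissible» for EVERY `(ε, χ)` and every conjugate-symplectic weight-one `μ` —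
and consumes it (✔ `UniformOmega.adjectives_rhoAt_prop413Data_of_def411AsPrinted_rest` → the `h411` binder of ✔ `PinSignatures.thm418C_liuDictionaryPin_of_pins`)
ONLY at the ADMISSIBLE triples of `(𝕌 i).prop413Data (𝔇).H`.  There, two of the three adjectives are ALREADY THEOREMS of this lineage at the
representative rests `restOfCharRep … δ′ r μ hμ hw` (✔ `Transposition/Item6RestOfCharRep.lean`): irreducibility from [Liu2021, App. D Lem. D.1 (1)]
AS PRINTED per place (`rhoAt_restOfCharRep_isIrreducible_of_lemD1AsPrinted`; survival ✔ `Def411WeilCarriers.survival`) and smoothness BY VALUE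
(`rhoAt_restOfCharRep_smooth`, `ιV` continuous).  This file packages that: the `h411` slot is filled from the per-place `hD1` family (the END's
`hD1'` ∕ (A) `Thm418CAtPin`'s `hD1`, unguarded) plus ADMISSIBILITY AT ADMISSIBLE INDICES ONLY (`hadm`).  The sibling
`CorCM/D2Bridge/AdapterMuConjDef411OfThm418.lean` then DERIVES `hadm` from [Liu2021, Thm. 4.18] AS PRINTED (the END's displayed `hLiu'` ∕ `hLiuC`) and
`𝒜(μ) ≠ ∅` (the displayed `h21`) via ✔ `Liu2021/AppendixC/Thm418SummandsAdmissible.lean` (Mumford §19 Thm. 3), so that the `h411` slot is filled from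
{`hD1`, `hLiu`, `h21`} alone.  Theorems only (kernel lane); count-neutral; no pointer ∕ label ∕ count moves; HC_CM is NOT proved; «Δ2 BRIDGE CLOSED» is NOT claimed.
-/
import Summits.HodgeConjecture.CorCM.B01.Transposition.Item6UniformOmegaRep
import Literature.NumberTheory.Automorphic.Liu2021.Def411AsPrinted
import HarnessLib

set_option autoImplicit false

/-!
# [Liu2021, Def. 4.11]'s adjectives at `Model.uniformOmegaRep` from Lem. D.1 (1) per place + admissibility at admissible indices

With `U := Model.uniformOmegaRep h F ι₁ V Φ e dV hdV hdV0 ιV δ′ r` and the one-object tails, `U.rest (restTailOne …)` IS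
`restOfCharRep … δ′ (r μ hμ) μ hμ hw` (✔ `Model.restOfCharRep_eq_rest`, `rfl`), and an admissible triple `t = (μ, ε, χ)` of `U.prop413Data H`
IS the admissible index `⟨(ε, χ), t.2.2⟩` of Thm. 4.18's datum at that rest, with the same summand `ω_t` ON THE NOSE
(✔ `UniformOmega.omegaAt_toThm418Data_rest`).  Hence:

* `Model.adjectives_rhoAt_uniformOmegaRep_of_admIndex` — the `h411` binder of the Prop-4.13 pay-off ∕ of
  `PinSignatures.thm418C_liuDictionaryPin_of_pins` (adjectives at every admissible TRIPLE of `U.prop413Data H`) follows from the three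
  adjectives at every admissible INDEX of the rests `restOfCharRep … δ′ (r μ hμ) μ hμ hw` — Def. 4.11's sentence is needed at `𝔈(μ)`-admissible
  `ε` only, never at the other collections;
* `Model.adjectives_rhoAt_uniformOmegaRep_of_lemD1AsPrinted_of_isAdmissibleRep` — **the `h411` slot from `hD1` + admissibility alone**: for
  `ιV` continuous and onto and `3 ≤ n`, GIVEN [Liu2021, App. D Lem. D.1, first sentence + (1)] AS PRINTED at the `μ`-attached local data on the
  line `⟨r μ hμ ε⟩` at every finite place (`hD1`, the shape of ✔ `rhoAt_restOfCharRep_isIrreducible_of_lemD1AsPrinted`) and the ADMISSIBILITY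
  of `ω(μ, ε, χ)` at admissible `(ε, χ)` (`hadm`), every summand of `U.prop413Data H` is irreducible-or-zero (Lem. D.1 ⇒ `IsIrreducible` ⇒
  `IsIrreducibleOrZero`), smooth (`rhoAt_restOfCharRep_smooth`, a theorem) and admissible (`hadm`).

So a consumer displaying `h411` may display instead the per-place Lem. D.1 family it already carries for `ω ≠ 0` and the single clause
«`ω(μ, ε, χ)` is admissible for `μ`-admissible `ε`» — itself a consequence of the displayed [Liu2021, Thm. 4.18] (sibling
`CorCM/D2Bridge/AdapterMuConjDef411OfThm418.lean`: `Model.adjectives_rhoAt_uniformOmegaRep_of_lemD1AsPrinted_of_thm418AsPrinted`).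
Nothing of [Liu2021] is asserted here: `hD1` and `hadm` are hypotheses.

## References
* [Liu2021] Y. Liu, *Fourier–Jacobi cycles and arithmetic relative trace formula*, Camb. J. Math. 9 (2021) 1–147 = arXiv:2102.11518 —
  Def. 4.11 (FJcycle.tex ll. 2083–2097), Def. 4.12 (ll. 2102–2108), Prop. 4.13 (ll. 2113–2119), App. D §D.1 Lem. D.1 (l. 5227; (1) l. 5229).
* [GelbartRogawski1991] S. Gelbart, J. Rogawski, Invent. Math. 105 (1991), §3.1 Prop. 3.1.1 p. 455 L1–3.
* Tree: `Transposition/Item6UniformOmegaRep.lean` (`uniformOmegaRep`, `restOfCharRep_eq_rest`), `Transposition/Item6RestOfCharRep.lean`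
  (`rhoAt_restOfCharRep_smooth`, `rhoAt_restOfCharRep_isIrreducible_of_lemD1AsPrinted`), `Liu2021/Def411AsPrinted.lean`
  (`IsIrreducibleOrZero`, `IsSmoothRep`, `IsAdmissibleRep`, `isIrreducibleOrZero_of_isIrreducible`), `Liu2021/LemD1AsPrinted.lean`,
  `AppendixC/Prop413DataOfTower.lean` (`UniformOmega.prop413Data`, `AdmTriple`), `AppendixC/UniformOmegaCiteLegs.lean` (the Def-4.11 leg this file shrinks).

HC_CM is NOT proved.
-/

noncomputable section

namespace Summit.HodgeConjecture.CorCM.Model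

open NumberField IsDedekindDomain
open Literature.AlgebraicGeometry.Motives
open Literature.AlgebraicGeometry.ShimuraVarieties.UnitaryCanonicalModel
open Literature.NumberTheory.Automorphic
open Literature.NumberTheory.Automorphic.IdeleClassGroup
open Literature.NumberTheory.ComplexMultiplication
open Literature.NumberTheory.Automorphic.Liu2021
open Literature.NumberTheory.Automorphic.Liu2021.AppendixC
open Literature.NumberTheory.Automorphic.Liu2021.AppendixC.RestOne
open Literature.NumberTheory.Automorphic.Liu2021.Def411WeilCarriers (Rep lineOf)
open Literature.NumberTheory.GelbartRogawski1991 Literature.NumberTheory.GelbartRogawski1991.UnitaryDualPair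
open Literature.NumberTheory.GelbartRogawski1991.UnitaryDualPair.LocalSplitting (localMu norm_localMu continuous_localMu localMu_toLocalRing_eq_one_iff)
open Literature.RepresentationTheory
open Literature.RepresentationTheory.Liu2021
open Summit.HodgeConjecture.CorCM.Transposition

section Frame

-- (every binder explicit per theorem — no section `variable` carrying the named fact `h`)

/-- **The `h411` binder of the Prop-4.13 pay-off needs Def. 4.11's adjectives at ADMISSIBLE indices only.**  If, for every conjugate-symplectic
weight-one `μ` and every admissible index `j = (ε, χ)` of Thm. 4.18's datum at the rest `restOfCharRep … δ′ (r μ hμ) μ hμ hw`, the summand `ω_j` is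
irreducible-or-zero, smooth and admissible, then so is every summand `ω_t` of `(uniformOmegaRep … δ′ r).prop413Data H` (same representation ON THE
NOSE at `t ↦ ⟨(t.ε, t.χ), t.adm⟩`, ✔ `restOfCharRep_eq_rest` ∕ `UniformOmega.omegaAt_toThm418Data_rest`). [cite: Liu2021, Def. 4.11 (ll. 2083–2097), Def. 4.12, Prop. 4.13] -/
theorem adjectives_rhoAt_uniformOmegaRep_of_admIndex
    (h : exists_recordSystem) (F : CMField) [IsGalois ℚ F] (h6 : 6 ≤ Module.finrank ℚ F)
    (ι₁ : F →+* ℂ) (V : HermSpace3 F ι₁) (Φ : CMType F) {n : ℕ} (e : Fin 3 × Fin 1 ≃ Fin n) (dV : Fin 3 → F)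
    (hdV : ∀ i, IsCMField.complexConj F (dV i) = dV i) (hdV0 : ∀ i, dV i ≠ 0)
    (ιV : (sec42DataOf h isoOf F ι₁ V Φ).G →*
      UnitaryGroup.finAdelic ↥(maximalRealSubfield F) F (IsCMField.complexConj F) 3 (Matrix.diagonal dV))
    (δ' : F) (r : ∀ μ : Literature.NumberTheory.Automorphic.IdeleClassGroup F →ₜ* Circle,
      IdeleClassGroup.IsConjugateSymplectic F μ → Rep ↥(maximalRealSubfield F) (imagUnitSq F))
    (H : Type) [AddCommGroup H] [Module ℂ H] [Module (MonoidAlgebra ℂ (sec42DataOf h isoOf F ι₁ V Φ).G) H]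
    [IsScalarTower ℂ (MonoidAlgebra ℂ (sec42DataOf h isoOf F ι₁ V Φ).G) H]
    (hadj : ∀ (μ : Literature.NumberTheory.Automorphic.IdeleClassGroup F →ₜ* Circle) (hμ : IdeleClassGroup.IsConjugateSymplectic F μ)
      (hw : IdeleClassGroup.HasWeight F μ 1)
      (j : (toThm418Data (sec42DataOf h isoOf F ι₁ V Φ) (restOfCharRep h F h6 ι₁ V Φ e dV hdV hdV0 ιV δ' (r μ hμ) μ hμ hw)).AdmIndex),
      IsIrreducibleOrZero ((toThm418Data (sec42DataOf h isoOf F ι₁ V Φ) (restOfCharRep h F h6 ι₁ V Φ e dV hdV hdV0 ιV δ' (r μ hμ) μ hμ hw)).rhoAt j) ∧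
        IsSmoothRep ((toThm418Data (sec42DataOf h isoOf F ι₁ V Φ) (restOfCharRep h F h6 ι₁ V Φ e dV hdV hdV0 ιV δ' (r μ hμ) μ hμ hw)).rhoAt j) ∧
        IsAdmissibleRep ((toThm418Data (sec42DataOf h isoOf F ι₁ V Φ) (restOfCharRep h F h6 ι₁ V Φ e dV hdV hdV0 ιV δ' (r μ hμ) μ hμ hw)).rhoAt j))
    (t : ((uniformOmegaRep h F ι₁ V Φ e dV hdV hdV0 ιV δ' r).prop413Data H).AdmTriple) :
    IsIrreducibleOrZero (((uniformOmegaRep h F ι₁ V Φ e dV hdV hdV0 ιV δ' r).prop413Data H).rhoAt t) ∧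
      IsSmoothRep (((uniformOmegaRep h F ι₁ V Φ e dV hdV hdV0 ιV δ' r).prop413Data H).rhoAt t) ∧
      IsAdmissibleRep (((uniformOmegaRep h F ι₁ V Φ e dV hdV hdV0 ιV δ' r).prop413Data H).rhoAt t) :=
  hadj t.1.μ t.1.isConjugateSymplectic t.2.1 ⟨(t.1.ε, t.1.χ), t.2.2⟩

/-- **h411 SHRINK — the `h411` slot from [Liu2021, App. D Lem. D.1 (1)] per place + admissibility at admissible indices.**  For `ιV` continuous and
onto and `3 ≤ n`: GIVEN, for every conjugate-symplectic weight-one `μ` and every admissible index `j = (ε, χ)` of the rest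
`restOfCharRep … δ′ (r μ hμ) μ hμ hw`, (i) `hD1` = [Liu2021, App. D Lem. D.1, first sentence + (1)] AS PRINTED at the `μ`-attached local datum on the
line `⟨r μ hμ ε⟩` at EVERY finite place `v` (verbatim the hypothesis of ✔ `rhoAt_restOfCharRep_isIrreducible_of_lemD1AsPrinted`) and (ii) `hadm` =
«`ω(μ, ε, χ)` is admissible» ([Liu2021, Def. 4.11], the one adjective not derived in the tree), every summand `ω_t` of
`(uniformOmegaRep … δ′ r).prop413Data H` is irreducible-or-zero (a THEOREM: Lem. D.1 ⇒ irreducible, survival ✔ `Def411WeilCarriers.survival`),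
smooth (a THEOREM: `rhoAt_restOfCharRep_smooth`) and admissible (`hadm`) — the `h411` binder of ✔ `PinSignatures.thm418C_liuDictionaryPin_of_pins`
∕ of the Prop-4.13 pay-off, with Def. 4.11's irreducibility and smoothness conjuncts NO LONGER POSITED.  Nothing of [Liu2021] is asserted.
[cite: Liu2021, Def. 4.11 (FJcycle.tex ll. 2083–2097), Def. 4.12 (ll. 2102–2108), App. D Lemma D.1 (l. 5227; (1) l. 5229)]
[cite: GelbartRogawski1991, §3.1 Prop. 3.1.1 p. 455 L1–3] -/
theorem adjectives_rhoAt_uniformOmegaRep_of_lemD1AsPrinted_of_isAdmissibleRep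
    (h : exists_recordSystem) (F : CMField) [IsGalois ℚ F] (h6 : 6 ≤ Module.finrank ℚ F)
    (ι₁ : F →+* ℂ) (V : HermSpace3 F ι₁) (Φ : CMType F) {n : ℕ} (e : Fin 3 × Fin 1 ≃ Fin n) (dV : Fin 3 → F)
    (hdV : ∀ i, IsCMField.complexConj F (dV i) = dV i) (hdV0 : ∀ i, dV i ≠ 0)
    (ιV : (sec42DataOf h isoOf F ι₁ V Φ).G →*
      UnitaryGroup.finAdelic ↥(maximalRealSubfield F) F (IsCMField.complexConj F) 3 (Matrix.diagonal dV))
    (δ' : F) (r : ∀ μ : Literature.NumberTheory.Automorphic.IdeleClassGroup F →ₜ* Circle,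
      IdeleClassGroup.IsConjugateSymplectic F μ → Rep ↥(maximalRealSubfield F) (imagUnitSq F))
    (H : Type) [AddCommGroup H] [Module ℂ H] [Module (MonoidAlgebra ℂ (sec42DataOf h isoOf F ι₁ V Φ).G) H]
    [IsScalarTower ℂ (MonoidAlgebra ℂ (sec42DataOf h isoOf F ι₁ V Φ).G) H]
    (hιc : Continuous ιV) (hιs : Function.Surjective ιV) (hn : 3 ≤ n)
    (hD1 : ∀ (μ : Literature.NumberTheory.Automorphic.IdeleClassGroup F →ₜ* Circle) (hμ : IdeleClassGroup.IsConjugateSymplectic F μ)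
      (hw : IdeleClassGroup.HasWeight F μ 1)
      (j : (toThm418Data (sec42DataOf h isoOf F ι₁ V Φ) (restOfCharRep h F h6 ι₁ V Φ e dV hdV hdV0 ιV δ' (r μ hμ) μ hμ hw)).AdmIndex)
      (v : HeightOneSpectrum (𝓞 ↥(maximalRealSubfield F))), LemD1_1AsPrinted
      (Def411WeilCarriers.localLemD1Data ↥(maximalRealSubfield F) F (IsCMField.complexConj F) 3 e (Matrix.diagonal dV)
        (complexConj_imagUnit F) (imagUnit_ne_zero F) (imagUnit_mul_self F) (realDiagonal_isSymm F dV hdV)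
        (isUnit_det_realDiagonal F dV hdV hdV0) (realDiagonal_map F dV hdV).symm ((r μ hμ).toFun j.1.1)
        (OmegaChiSplitting.chiLocalSplittingsD F e dV hdV hdV0 (toHeckeCharacter F μ) ((isOscillatorChar_toHeckeCharacter_iff μ).mpr hμ)
          ((r μ hμ).toFun j.1.1))
        hn (localMu F (toHeckeCharacter F μ))
        (fun v x => norm_localMu F (toHeckeCharacter F μ) v (isUnitary_toHeckeCharacter F μ) x)
        (continuous_localMu F (toHeckeCharacter F μ))
        (fun v t => localMu_toLocalRing_eq_one_iff F (toHeckeCharacter F μ) v ((isOscillatorChar_toHeckeCharacter_iff μ).mpr hμ) t)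
        j.1.2.1
        (Def411WeilCarriers.norm_chi_eq_one ↥(maximalRealSubfield F) F (IsCMField.complexConj F)
          (Algebra.IsQuadraticExtension.finrank_eq_two ↥(maximalRealSubfield F) F)
          (UnitaryGroup.algEquiv_ne_one_of_apply_eq_neg ↥(maximalRealSubfield F) F (IsCMField.complexConj F) (complexConj_imagUnit F)
            (imagUnit_ne_zero F)) j.1.2)
        j.1.2.2.1 v))
    (hadm : ∀ (μ : Literature.NumberTheory.Automorphic.IdeleClassGroup F →ₜ* Circle) (hμ : IdeleClassGroup.IsConjugateSymplectic F μ)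
      (hw : IdeleClassGroup.HasWeight F μ 1)
      (j : (toThm418Data (sec42DataOf h isoOf F ι₁ V Φ) (restOfCharRep h F h6 ι₁ V Φ e dV hdV hdV0 ιV δ' (r μ hμ) μ hμ hw)).AdmIndex),
      IsAdmissibleRep ((toThm418Data (sec42DataOf h isoOf F ι₁ V Φ) (restOfCharRep h F h6 ι₁ V Φ e dV hdV hdV0 ιV δ' (r μ hμ) μ hμ hw)).rhoAt j))
    (t : ((uniformOmegaRep h F ι₁ V Φ e dV hdV hdV0 ιV δ' r).prop413Data H).AdmTriple) :
    IsIrreducibleOrZero (((uniformOmegaRep h F ι₁ V Φ e dV hdV hdV0 ιV δ' r).prop413Data H).rhoAt t) ∧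
      IsSmoothRep (((uniformOmegaRep h F ι₁ V Φ e dV hdV hdV0 ιV δ' r).prop413Data H).rhoAt t) ∧
      IsAdmissibleRep (((uniformOmegaRep h F ι₁ V Φ e dV hdV hdV0 ιV δ' r).prop413Data H).rhoAt t) :=
  adjectives_rhoAt_uniformOmegaRep_of_admIndex h F h6 ι₁ V Φ e dV hdV hdV0 ιV δ' r H
    (fun μ hμ hw j =>
      ⟨isIrreducibleOrZero_of_isIrreducible
          (rhoAt_restOfCharRep_isIrreducible_of_lemD1AsPrinted h F h6 ι₁ V Φ e dV hdV hdV0 ιV δ' (r μ hμ) μ hμ hw hιs hn j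
            (hD1 μ hμ hw j)),
        fun v => rhoAt_restOfCharRep_smooth h F h6 ι₁ V Φ e dV hdV hdV0 ιV δ' (r μ hμ) μ hμ hw hιc j v,
        hadm μ hμ hw j⟩)
    t

end Frame

end Summit.HodgeConjecture.CorCM.Model

end
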